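import Summits.QuantumFields.QCD.Theorems.SpectralDefectExtinctionTipNoBindingStubSobolevSup
import Literature.MathematicalPhysics.QuantumLattice.OverlapLocality

/-!
# The free Wilson–Dirac operator in torus Fourier variables
(helpers for stub `stub_noLeak` of line `positivity-no-leak-spread`, crux
`Summit.QuantumFields.QCD.Theses.SpectralDefectExtinction.TipNoBinding`, item stmt-QuantumFields-8965)

For the FREE (`U = 1`) massless `r = 1` Wilson–Dirac operator `D₀ = wilsonDirac ρ 1 0 1` on the four-torus
`(ℤ/L)⁴` (colour `Fin 3`, spin `Fin 4`) and a real number `t`: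

* `wilsonDirac_one_mulVec_apply` — the entrywise action
  `(D₀ψ)(x,a,α) = 4ψ(x,a,α) − ½ Σ_μ Σ_β [(1 − γ_μ)_{αβ} ψ(x+μ̂,a,β) + (1 + γ_μ)_{αβ} ψ(x−μ̂,a,β)]`;
* `torusFourier_free_sub_apply` — in the torus Fourier variables of the landed toolkit
  (`Literature.Probability.LatticeModels.torusFourier`, shift multipliers `torusFourier_comp_add/sub`),
  `D₀ − t` acts on each colour component by the `4 × 4` symbol `(W − t)·1 + i Σ_μ sin θ_μ γ_μ`,
  `θ_μ = 2π k_μ.val / L`, `W = Σ_μ (1 − cos θ_μ)`;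
* `clifford_conjTranspose_mul_self` — that symbol `M` is normal with `Mᴴ M = ((W − t)² + Σ_μ sin² θ_μ)·1`
  (Hermiticity and the Clifford relations of the tree's `euclideanGamma`), hence
  `sum_norm_sq_torusFourier_free_sub`: `Σ_α |𝓕((D₀ − t)ψ(·,a,α))(k)|² = q(k) Σ_α |𝓕(ψ(·,a,α))(k)|²`;
* `symbol_sq_lower_bound` — `q(k) ≥ (3/4) ε_L(k)` for `t ≤ 1/4`, `ε_L(k) = Σ_μ 4 sin²(π k_μ.val / L)`, via the
  sum-of-squares identity `q = t² + 2(1 − t)W + Σ_{μ≠ν} w_μ w_ν`; and `symbol_sq_zero`: `q(0) = t²`.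

References: Montvay–Münster §4.2 (free Wilson fermion in momentum space); the Clifford step is folklore.
Pure theorem file (no definitions); serves the lead's skeleton `work/TipNoBinding.lean`.
-/

namespace Summit.QuantumFields.QCD.Cruxes.TipNoBinding.PositivityNoLeakSpread

open Literature.MathematicalPhysics Literature.MathematicalPhysics.QuantumLattice
  Literature.MathematicalPhysics.QuantumFieldTheory Literature.Probability.LatticeModels
open Matrix Complex Finset
open scoped ComplexConjugate Real

section FreeAction

variable {L : ℕ} [NeZero L]

/-- **Entrywise action of the FREE massless `r = 1` Wilson–Dirac operator** (`U = 1`):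
`(D₀ψ)(x,a,α) = 4ψ(x,a,α) − ½ Σ_μ Σ_β [(1 − γ_μ)_{αβ} ψ(x+μ̂,a,β) + (1 + γ_μ)_{αβ} ψ(x−μ̂,a,β)]`,
valid on every torus `(ℤ/L)⁴`, `L ≥ 1` (colour-diagonal since `ρ(1) = 1`). -/
theorem wilsonDirac_one_mulVec_apply (ψ : TorusSite 4 L × Fin 3 × Fin 4 → ℂ)
    (x : TorusSite 4 L) (a : Fin 3) (α : Fin 4) :
    (wilsonDirac (fundamentalRep (Fin 3))
        (1 : GaugeConfig 4 L ↥(Matrix.specialUnitaryGroup (Fin 3) ℂ)) 0 1 *ᵥ ψ) (x, a, α) =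
      4 * ψ (x, a, α) - (1 / 2) * ∑ μ, ∑ β,
        ((1 - euclideanGamma μ) α β * ψ (x + Pi.single μ 1, a, β) +
          (1 + euclideanGamma μ) α β * ψ (x - Pi.single μ 1, a, β)) := by
  have hf : ∀ μ : Fin 4, ∑ q : TorusSite 4 L × Fin 3 × Fin 4,
      (if q.1 = QuantumFieldTheory.Site.shift x μ then
          (1 - euclideanGamma μ) α q.2.2 * (1 : Matrix (Fin 3) (Fin 3) ℂ) a q.2.1 else 0) * ψ q =
        ∑ β, (1 - euclideanGamma μ) α β * ψ (x + Pi.single μ 1, a, β) := by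
    intro μ
    rw [Fintype.sum_prod_type, Finset.sum_eq_single (QuantumFieldTheory.Site.shift x μ)]
    · rw [Fintype.sum_prod_type, Finset.sum_eq_single a]
      · simp [QuantumFieldTheory.Site.shift]
      · intro b _ hb
        simp [Matrix.one_apply_ne (Ne.symm hb)]
      · simp
    · intro y _ hy
      simp [if_neg hy]
    · simp
  have hb : ∀ μ : Fin 4, ∑ q : TorusSite 4 L × Fin 3 × Fin 4,
      (if x = QuantumFieldTheory.Site.shift q.1 μ then
          (1 + euclideanGamma μ) α q.2.2 * (1 : Matrix (Fin 3) (Fin 3) ℂ) a q.2.1 else 0) * ψ q =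
        ∑ β, (1 + euclideanGamma μ) α β * ψ (x - Pi.single μ 1, a, β) := by
    intro μ
    simp_rw [eq_shift_iff]
    rw [Fintype.sum_prod_type, Finset.sum_eq_single (x - Pi.single μ 1)]
    · rw [Fintype.sum_prod_type, Finset.sum_eq_single a]
      · simp
      · intro b _ hb
        simp [Matrix.one_apply_ne (Ne.symm hb)]
      · simp
    · intro y _ hy
      simp [if_neg hy]
    · simp
  simp only [mulVec, dotProduct, wilsonDirac, of_apply, Pi.one_apply, inv_one, map_one,
    Complex.ofReal_one, one_smul, sub_mul, Finset.sum_sub_distrib]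
  congr 1
  · rw [Finset.sum_eq_single (x, a, α)]
    · simp
    · intro q _ hq
      rw [if_neg (Ne.symm hq), zero_mul]
    · intro h; exact absurd (Finset.mem_univ _) h
  · simp_rw [Finset.mul_sum, Finset.sum_mul]
    rw [Finset.sum_comm]
    refine Finset.sum_congr rfl fun μ _ => ?_
    simp_rw [mul_assoc, ← Finset.mul_sum]
    congr 1
    simp_rw [add_mul, Finset.sum_add_distrib, hf, hb]

end FreeAction

section FreeFourier

variable {L : ℕ} [NeZero L]

/-- `torusFourier` of a finite sum of functions is the sum of the transforms. -/
theorem torusFourier_finset_sum {d : ℕ} {ι : Type*} (s : Finset ι) (f : ι → TorusSite d L → ℂ)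
    (k : TorusSite d L) :
    torusFourier (fun x => ∑ i ∈ s, f i x) k = ∑ i ∈ s, torusFourier (f i) k := by
  simp only [torusFourier_eq_sum_torusChar, Finset.sum_mul]
  rw [Finset.sum_comm]

/-- `torusFourier` is additive (pointwise form). -/
theorem torusFourier_add' {d : ℕ} (f g : TorusSite d L → ℂ) (k : TorusSite d L) :
    torusFourier (fun x => f x + g x) k = torusFourier f k + torusFourier g k :=
  torusFourier_add f g k

/-- `torusFourier` commutes with subtraction (pointwise form). -/
theorem torusFourier_sub' {d : ℕ} (f g : TorusSite d L → ℂ) (k : TorusSite d L) :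
    torusFourier (fun x => f x - g x) k = torusFourier f k - torusFourier g k :=
  torusFourier_sub f g k

/-- **The free Wilson–Dirac operator in Fourier variables** (per colour `a`, at momentum `k`):
with `θ_μ = 2π k_μ.val / L`, `W = Σ_μ (1 − cos θ_μ)`, `s_μ = sin θ_μ` and `Ψ_β = 𝓕(ψ(·,a,β))(k)`,
`𝓕((D₀ − t)ψ(·,a,α))(k) = (W − t) Ψ_α + i Σ_β (Σ_μ s_μ γ_μ)_{αβ} Ψ_β`, i.e. the symbol of `D₀ − t` is the
NORMAL matrix `(W − t)·1 + iγ·s` (the `γ_μ` halves of the two hopping terms combine to `i sin θ_μ γ_μ`,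
the `r = 1` halves to `−cos θ_μ`). -/
theorem torusFourier_free_sub_apply (ψ : TorusSite 4 L × Fin 3 × Fin 4 → ℂ) (t : ℝ)
    (k : TorusSite 4 L) (a : Fin 3) (α : Fin 4) :
    torusFourier (fun x => (wilsonDirac (fundamentalRep (Fin 3))
        (1 : GaugeConfig 4 L ↥(Matrix.specialUnitaryGroup (Fin 3) ℂ)) 0 1 *ᵥ ψ - (t : ℂ) • ψ)
          (x, a, α)) k =
      (((∑ μ, (1 - Real.cos (2 * π * ((k μ).val : ℝ) / L))) - t : ℝ) : ℂ) *
          torusFourier (fun x => ψ (x, a, α)) k +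
        I * ∑ β, (∑ μ, ((Real.sin (2 * π * ((k μ).val : ℝ) / L) : ℝ) : ℂ) • euclideanGamma μ) α β *
          torusFourier (fun x => ψ (x, a, β)) k := by
  -- the character at a unit vector and its conjugate, in terms of `cos θ_μ`, `sin θ_μ`
  have hχ : ∀ μ : Fin 4, torusChar k (Pi.single μ 1) =
      ((Real.cos (2 * π * ((k μ).val : ℝ) / L) : ℝ) : ℂ) +
        ((Real.sin (2 * π * ((k μ).val : ℝ) / L) : ℝ) : ℂ) * I := by
    intro μ
    rw [torusChar_single_eq_exp, Complex.exp_mul_I, ← Complex.ofReal_cos, ← Complex.ofReal_sin]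
  have hχc : ∀ μ : Fin 4, conj (torusChar k (Pi.single μ 1)) =
      ((Real.cos (2 * π * ((k μ).val : ℝ) / L) : ℝ) : ℂ) -
        ((Real.sin (2 * π * ((k μ).val : ℝ) / L) : ℝ) : ℂ) * I := by
    intro μ
    rw [hχ, map_add, map_mul, Complex.conj_ofReal, Complex.conj_ofReal, Complex.conj_I]
    ring
  -- one hopping term (direction `μ`, spin component `β`) in Fourier variables
  have h1 : ∀ μ β : Fin 4, torusFourier (fun x =>
      (1 - euclideanGamma μ) α β * ψ (x + Pi.single μ 1, a, β) +
        (1 + euclideanGamma μ) α β * ψ (x - Pi.single μ 1, a, β)) k =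
      (if α = β then 2 * ((Real.cos (2 * π * ((k μ).val : ℝ) / L) : ℝ) : ℂ) *
          torusFourier (fun x => ψ (x, a, β)) k else 0) -
        2 * (((Real.sin (2 * π * ((k μ).val : ℝ) / L) : ℝ) : ℂ) * I) *
          (euclideanGamma μ α β * torusFourier (fun x => ψ (x, a, β)) k) := by
    intro μ β
    rw [torusFourier_add', torusFourier_const_mul, torusFourier_const_mul,
      torusFourier_comp_add (fun x => ψ (x, a, β)), torusFourier_comp_sub (fun x => ψ (x, a, β)),
      hχc, hχ, Matrix.sub_apply, Matrix.add_apply, Matrix.one_apply]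
    split_ifs <;> ring
  -- the whole hopping part in Fourier variables
  have hhop : torusFourier (fun x => ∑ μ, ∑ β,
      ((1 - euclideanGamma μ) α β * ψ (x + Pi.single μ 1, a, β) +
        (1 + euclideanGamma μ) α β * ψ (x - Pi.single μ 1, a, β))) k =
      2 * (∑ μ, ((Real.cos (2 * π * ((k μ).val : ℝ) / L) : ℝ) : ℂ)) *
          torusFourier (fun x => ψ (x, a, α)) k -
        2 * (I * ∑ β, (∑ μ, ((Real.sin (2 * π * ((k μ).val : ℝ) / L) : ℝ) : ℂ) •
          euclideanGamma μ) α β * torusFourier (fun x => ψ (x, a, β)) k) := by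
    have h2 : ∀ μ : Fin 4, torusFourier (fun x => ∑ β,
        ((1 - euclideanGamma μ) α β * ψ (x + Pi.single μ 1, a, β) +
          (1 + euclideanGamma μ) α β * ψ (x - Pi.single μ 1, a, β))) k =
        2 * ((Real.cos (2 * π * ((k μ).val : ℝ) / L) : ℝ) : ℂ) * torusFourier (fun x => ψ (x, a, α)) k -
          2 * (((Real.sin (2 * π * ((k μ).val : ℝ) / L) : ℝ) : ℂ) * I) *
            ∑ β, euclideanGamma μ α β * torusFourier (fun x => ψ (x, a, β)) k := by
      intro μ
      rw [torusFourier_finset_sum, Finset.sum_congr rfl fun β _ => h1 μ β, Finset.sum_sub_distrib,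
        Finset.sum_ite_eq, if_pos (Finset.mem_univ _), ← Finset.mul_sum]
    rw [torusFourier_finset_sum, Finset.sum_congr rfl fun μ _ => h2 μ, Finset.sum_sub_distrib,
      ← Finset.sum_mul, ← Finset.mul_sum]
    congr 1
    simp only [Matrix.sum_apply, Matrix.smul_apply, smul_eq_mul, Finset.mul_sum, Finset.sum_mul]
    conv_lhs => rw [Finset.sum_comm]
    refine Finset.sum_congr rfl fun β _ => Finset.sum_congr rfl fun μ _ => ?_
    ring
  -- assemble
  simp only [Pi.sub_apply, Pi.smul_apply, smul_eq_mul, wilsonDirac_one_mulVec_apply]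
  rw [torusFourier_sub', torusFourier_sub', torusFourier_const_mul, torusFourier_const_mul,
    torusFourier_const_mul, hhop]
  push_cast
  rw [Finset.sum_sub_distrib]
  simp only [Finset.sum_const, Finset.card_univ, Fintype.card_fin]
  ring

end FreeFourier

section Clifford

/-- For a complex square matrix with `Mᴴ M = c • 1` (`c` real): `Σ_i ‖(M v)_i‖² = c · Σ_i ‖v_i‖²`. -/
theorem sum_norm_sq_mulVec_of_conjTranspose_mul_self {n : Type*} [Fintype n] [DecidableEq n]
    (M : Matrix n n ℂ) (c : ℝ) (hM : Mᴴ * M = (c : ℂ) • (1 : Matrix n n ℂ)) (v : n → ℂ) :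
    ∑ i, ‖(M *ᵥ v) i‖ ^ 2 = c * ∑ i, ‖v i‖ ^ 2 := by
  have key : ∀ w : n → ℂ, ∑ i, ‖w i‖ ^ 2 = (star w ⬝ᵥ w).re := by
    intro w
    rw [dotProduct, Complex.re_sum]
    refine Finset.sum_congr rfl fun i _ => ?_
    rw [Pi.star_apply, Complex.star_def, ← Complex.normSq_eq_conj_mul_self, Complex.ofReal_re,
      Complex.normSq_eq_norm_sq]
  rw [key, key, star_mulVec, ← dotProduct_mulVec, mulVec_mulVec, hM, smul_mulVec, one_mulVec,
    dotProduct_smul, smul_eq_mul, Complex.re_ofReal_mul]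

/-- **Clifford**: for real `w` and `s_μ`, the matrix `M = w·1 + i Σ_μ s_μ γ_μ` satisfies
`Mᴴ M = (w² + Σ_μ s_μ²)·1` (`γ_μ` Hermitian, `{γ_μ, γ_ν} = 2δ_{μν}`): the symbol of the free massless
Wilson–Dirac operator minus a real number is NORMAL with `|symbol|² = (W − t)² + Σ sin² θ_μ`. -/
theorem clifford_conjTranspose_mul_self (w : ℝ) (s : Fin 4 → ℝ) :
    ((w : ℂ) • (1 : Matrix (Fin 4) (Fin 4) ℂ) + I • ∑ μ, ((s μ : ℝ) : ℂ) • euclideanGamma μ)ᴴ *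
        ((w : ℂ) • (1 : Matrix (Fin 4) (Fin 4) ℂ) + I • ∑ μ, ((s μ : ℝ) : ℂ) • euclideanGamma μ) =
      ((w ^ 2 + ∑ μ, s μ ^ 2 : ℝ) : ℂ) • (1 : Matrix (Fin 4) (Fin 4) ℂ) := by
  set Γ : Matrix (Fin 4) (Fin 4) ℂ := ∑ μ, ((s μ : ℝ) : ℂ) • euclideanGamma μ with hΓ
  -- `Γ` is Hermitian
  have hΓH : Γᴴ = Γ := by
    simp only [hΓ, conjTranspose_sum, conjTranspose_smul, (euclideanGamma_isHermitian _).eq,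
      Complex.star_def, Complex.conj_ofReal]
  -- `Γ² = (Σ s_μ²)·1` by the Clifford relations
  have hsm : ∀ (a b : ℂ) (A B : Matrix (Fin 4) (Fin 4) ℂ), (a • A) * (b • B) = (a * b) • (A * B) := by
    intro a b A B
    rw [Matrix.smul_mul, Matrix.mul_smul, smul_smul]
  have hA : Γ * Γ = ∑ μ, ∑ ν, (((s μ : ℝ) : ℂ) * ((s ν : ℝ) : ℂ)) • (euclideanGamma μ * euclideanGamma ν) := by
    simp only [hΓ, Finset.sum_mul, Finset.mul_sum, hsm]
    exact Finset.sum_comm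
  have h2A : Γ * Γ + Γ * Γ =
      ((∑ μ, s μ ^ 2 : ℝ) : ℂ) • (1 : Matrix (Fin 4) (Fin 4) ℂ) +
        ((∑ μ, s μ ^ 2 : ℝ) : ℂ) • (1 : Matrix (Fin 4) (Fin 4) ℂ) := by
    calc Γ * Γ + Γ * Γ
        = ∑ μ, ∑ ν, (((s μ : ℝ) : ℂ) * ((s ν : ℝ) : ℂ)) • (euclideanGamma μ * euclideanGamma ν) +
            ∑ μ, ∑ ν, (((s ν : ℝ) : ℂ) * ((s μ : ℝ) : ℂ)) • (euclideanGamma ν * euclideanGamma μ) := by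
          rw [hA]
          congr 1
          exact Finset.sum_comm
      _ = ∑ μ, ∑ ν, (((s μ : ℝ) : ℂ) * ((s ν : ℝ) : ℂ)) •
            (euclideanGamma μ * euclideanGamma ν + euclideanGamma ν * euclideanGamma μ) := by
          rw [← Finset.sum_add_distrib]
          refine Finset.sum_congr rfl fun μ _ => ?_
          rw [← Finset.sum_add_distrib]
          refine Finset.sum_congr rfl fun ν _ => ?_
          rw [smul_add, mul_comm ((s ν : ℝ) : ℂ)]
      _ = ∑ μ, ∑ ν, (((s μ : ℝ) : ℂ) * ((s ν : ℝ) : ℂ)) •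
            (if μ = ν then (2 : Matrix (Fin 4) (Fin 4) ℂ) else 0) := by
          refine Finset.sum_congr rfl fun μ _ => Finset.sum_congr rfl fun ν _ => ?_
          rw [euclideanGamma_anticomm_holds μ ν]
      _ = ∑ μ, (((s μ : ℝ) : ℂ) * ((s μ : ℝ) : ℂ)) • (2 : Matrix (Fin 4) (Fin 4) ℂ) := by
          refine Finset.sum_congr rfl fun μ _ => ?_
          simp_rw [smul_ite, smul_zero, Finset.sum_ite_eq, Finset.mem_univ, if_true]
      _ = ((∑ μ, s μ ^ 2 : ℝ) : ℂ) • (1 : Matrix (Fin 4) (Fin 4) ℂ) +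
            ((∑ μ, s μ ^ 2 : ℝ) : ℂ) • (1 : Matrix (Fin 4) (Fin 4) ℂ) := by
          rw [show (2 : Matrix (Fin 4) (Fin 4) ℂ) = 1 + 1 from one_add_one_eq_two.symm]
          simp_rw [smul_add]
          rw [Finset.sum_add_distrib, ← Finset.sum_smul]
          push_cast
          simp only [sq]
  have hΓ2 : Γ * Γ = ((∑ μ, s μ ^ 2 : ℝ) : ℂ) • (1 : Matrix (Fin 4) (Fin 4) ℂ) := by
    have h2 : (2 : ℂ) • (Γ * Γ) = (2 : ℂ) • (((∑ μ, s μ ^ 2 : ℝ) : ℂ) • (1 : Matrix (Fin 4) (Fin 4) ℂ)) := by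
      rw [two_smul, two_smul, h2A]
    calc Γ * Γ = (2 : ℂ)⁻¹ • ((2 : ℂ) • (Γ * Γ)) := by
          rw [smul_smul, inv_mul_cancel₀ two_ne_zero, one_smul]
      _ = ((∑ μ, s μ ^ 2 : ℝ) : ℂ) • (1 : Matrix (Fin 4) (Fin 4) ℂ) := by
          rw [h2, smul_smul, inv_mul_cancel₀ two_ne_zero, one_smul]
  -- expand `Mᴴ M`
  have hII : -I * I = 1 := by rw [neg_mul, Complex.I_mul_I, neg_neg]
  rw [conjTranspose_add, conjTranspose_smul, conjTranspose_smul, conjTranspose_one, hΓH,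
    Complex.star_def, Complex.conj_ofReal, Complex.conj_I, add_mul, mul_add, mul_add,
    hsm, hsm, hsm, hsm, Matrix.one_mul, Matrix.mul_one, Matrix.one_mul, hΓ2, smul_smul, hII, one_mul,
    add_assoc (((w : ℂ) * (w : ℂ)) • (1 : Matrix (Fin 4) (Fin 4) ℂ)), ← add_assoc (((w : ℂ) * I) • Γ),
    ← add_smul, show (w : ℂ) * I + -I * (w : ℂ) = 0 by ring, zero_smul, zero_add, ← add_smul]
  congr 1
  push_cast
  ring

end Clifford

section Symbol

/-- **`|symbol|²` per colour and momentum**: for every `ψ`, real `t`, momentum `k` and colour `a`,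
`Σ_α |𝓕((D₀ − t)ψ(·,a,α))(k)|² = ((W − t)² + Σ_μ sin² θ_μ) · Σ_α |𝓕(ψ(·,a,α))(k)|²` with
`θ_μ = 2π k_μ.val / L`, `W = Σ_μ (1 − cos θ_μ)` — the free operator is diagonal in `(k, a)` with the
normal symbol `(W − t) + iγ·s` (`torusFourier_free_sub_apply` and `clifford_conjTranspose_mul_self`). -/
theorem sum_norm_sq_torusFourier_free_sub :
    ∀ (L : ℕ) [NeZero L] (ψ : TorusSite 4 L × Fin 3 × Fin 4 → ℂ) (t : ℝ) (k : TorusSite 4 L) (a : Fin 3),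
      ∑ α, ‖torusFourier (fun x => (wilsonDirac (fundamentalRep (Fin 3))
          (1 : GaugeConfig 4 L ↥(Matrix.specialUnitaryGroup (Fin 3) ℂ)) 0 1 *ᵥ ψ - (t : ℂ) • ψ)
            (x, a, α)) k‖ ^ 2 =
        (((∑ μ, (1 - Real.cos (2 * Real.pi * ((k μ).val : ℝ) / L))) - t) ^ 2 +
            ∑ μ, Real.sin (2 * Real.pi * ((k μ).val : ℝ) / L) ^ 2) *
          ∑ α, ‖torusFourier (fun x => ψ (x, a, α)) k‖ ^ 2 := by
  intro L _ ψ t k a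
  set w : ℝ := (∑ μ, (1 - Real.cos (2 * π * ((k μ).val : ℝ) / L))) - t with hw
  set s : Fin 4 → ℝ := fun μ => Real.sin (2 * π * ((k μ).val : ℝ) / L) with hs
  set v : Fin 4 → ℂ := fun β => torusFourier (fun x => ψ (x, a, β)) k with hv
  set M : Matrix (Fin 4) (Fin 4) ℂ :=
    (w : ℂ) • (1 : Matrix (Fin 4) (Fin 4) ℂ) + I • ∑ μ, ((s μ : ℝ) : ℂ) • euclideanGamma μ with hM
  have hMv : ∀ α, torusFourier (fun x => (wilsonDirac (fundamentalRep (Fin 3))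
      (1 : GaugeConfig 4 L ↥(Matrix.specialUnitaryGroup (Fin 3) ℂ)) 0 1 *ᵥ ψ - (t : ℂ) • ψ)
        (x, a, α)) k = (M *ᵥ v) α := by
    intro α
    rw [torusFourier_free_sub_apply, hM, add_mulVec, smul_mulVec, smul_mulVec, one_mulVec,
      Pi.add_apply, Pi.smul_apply, Pi.smul_apply, smul_eq_mul, smul_eq_mul, mulVec, dotProduct]
  calc ∑ α, ‖torusFourier (fun x => (wilsonDirac (fundamentalRep (Fin 3))
        (1 : GaugeConfig 4 L ↥(Matrix.specialUnitaryGroup (Fin 3) ℂ)) 0 1 *ᵥ ψ - (t : ℂ) • ψ)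
          (x, a, α)) k‖ ^ 2
      = ∑ α, ‖(M *ᵥ v) α‖ ^ 2 := Finset.sum_congr rfl fun α _ => by rw [hMv]
    _ = (w ^ 2 + ∑ μ, s μ ^ 2) * ∑ α, ‖v α‖ ^ 2 :=
        sum_norm_sq_mulVec_of_conjTranspose_mul_self M _ (clifford_conjTranspose_mul_self w s) v

end Symbol


section SymbolBound

variable {L : ℕ}

/-- `1 − cos θ_μ = 2 sin²(θ_μ/2)`, i.e. `W(k) = ½ ε_L(k)` termwise, with `θ_μ = 2π k_μ.val / L`. -/
theorem one_sub_cos_eq_two_mul_sin_sq (k : TorusSite 4 L) (μ : Fin 4) :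
    1 - Real.cos (2 * π * ((k μ).val : ℝ) / L) = 2 * Real.sin (π * ((k μ).val : ℝ) / L) ^ 2 := by
  rw [show 2 * π * ((k μ).val : ℝ) / L = 2 * (π * ((k μ).val : ℝ) / L) by ring, Real.cos_two_mul,
    Real.cos_sq']
  ring

/-- `sin² θ_μ = (1 − cos θ_μ)(1 + cos θ_μ)`. -/
theorem sin_sq_eq_one_sub_cos_mul (θ : ℝ) :
    Real.sin θ ^ 2 = (1 - Real.cos θ) * (1 + Real.cos θ) := by
  rw [Real.sin_sq]
  ring

/-- **Symbol lower bound off the zero mode** (the SOS form of the triage's `tip_symbol_bound_trig`):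
for `t ≤ 1/4` and every momentum `k`,
`(W − t)² + Σ_μ sin² θ_μ ≥ (3/4) ε_L(k)`, `ε_L(k) = Σ_μ 4 sin²(π k_μ.val / L) = 2W`, because
`(W − t)² + Σ sin² θ_μ = t² + 2(1 − t)W + Σ_{μ≠ν} w_μ w_ν ≥ (3/2) W` (`w_μ = 1 − cos θ_μ ≥ 0`). -/
theorem symbol_sq_lower_bound (t : ℝ) (ht : t ≤ 1 / 4) (k : TorusSite 4 L) :
    (3 / 4) * ∑ μ, 4 * Real.sin (π * ((k μ).val : ℝ) / L) ^ 2 ≤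
      ((∑ μ, (1 - Real.cos (2 * π * ((k μ).val : ℝ) / L))) - t) ^ 2 +
        ∑ μ, Real.sin (2 * π * ((k μ).val : ℝ) / L) ^ 2 := by
  -- abbreviate `w_μ = 1 − cos θ_μ`
  have hw0 : ∀ μ : Fin 4, 0 ≤ 1 - Real.cos (2 * π * ((k μ).val : ℝ) / L) := fun μ =>
    sub_nonneg.mpr (Real.cos_le_one _)
  have hw2 : ∀ μ : Fin 4, 1 - Real.cos (2 * π * ((k μ).val : ℝ) / L) ≤ 2 := fun μ => by
    linarith [Real.neg_one_le_cos (2 * π * ((k μ).val : ℝ) / L)]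
  have hε : ∑ μ, 4 * Real.sin (π * ((k μ).val : ℝ) / L) ^ 2 =
      2 * ∑ μ, (1 - Real.cos (2 * π * ((k μ).val : ℝ) / L)) := by
    rw [Finset.mul_sum]
    refine Finset.sum_congr rfl fun μ _ => ?_
    rw [one_sub_cos_eq_two_mul_sin_sq]
    ring
  have hs : ∑ μ, Real.sin (2 * π * ((k μ).val : ℝ) / L) ^ 2 =
      ∑ μ, (1 - Real.cos (2 * π * ((k μ).val : ℝ) / L)) *
        (2 - (1 - Real.cos (2 * π * ((k μ).val : ℝ) / L))) := by
    refine Finset.sum_congr rfl fun μ _ => ?_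
    rw [sin_sq_eq_one_sub_cos_mul]
    ring
  rw [hε, hs]
  -- now everything is a polynomial inequality in the four numbers `w_μ ∈ [0, 2]` and `t ≤ 1/4`
  simp only [Fin.sum_univ_four] at *
  set a := 1 - Real.cos (2 * π * ((k 0).val : ℝ) / L)
  set b := 1 - Real.cos (2 * π * ((k 1).val : ℝ) / L)
  set c := 1 - Real.cos (2 * π * ((k 2).val : ℝ) / L)
  set d := 1 - Real.cos (2 * π * ((k 3).val : ℝ) / L)
  have ha := hw0 0; have hb := hw0 1; have hc := hw0 2; have hd := hw0 3
  nlinarith [mul_nonneg ha hb, mul_nonneg ha hc, mul_nonneg ha hd, mul_nonneg hb hc, mul_nonneg hb hd,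
    mul_nonneg hc hd, sq_nonneg t, mul_nonneg (by linarith : (0 : ℝ) ≤ 1 / 4 - t) ha,
    mul_nonneg (by linarith : (0 : ℝ) ≤ 1 / 4 - t) hb, mul_nonneg (by linarith : (0 : ℝ) ≤ 1 / 4 - t) hc,
    mul_nonneg (by linarith : (0 : ℝ) ≤ 1 / 4 - t) hd]

/-- At the zero mode the symbol of `D₀ − t` is `−t`: `(W(0) − t)² + Σ sin² θ_μ(0) = t²`. -/
theorem symbol_sq_zero (t : ℝ) :
    ((∑ μ : Fin 4, (1 - Real.cos (2 * π * (((0 : TorusSite 4 L) μ).val : ℝ) / L))) - t) ^ 2 +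
        ∑ μ : Fin 4, Real.sin (2 * π * (((0 : TorusSite 4 L) μ).val : ℝ) / L) ^ 2 = t ^ 2 := by
  simp

end SymbolBound

end Summit.QuantumFields.QCD.Cruxes.TipNoBinding.PositivityNoLeakSpread
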